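import Literature.NumberTheory.EllipticCurves.SilvermanHeightCovolume
import Mathlib.NumberTheory.ModularForms.LevelOne.GradedRing
import Mathlib.NumberTheory.ModularForms.EisensteinSeries.QExpansion
import Mathlib.NumberTheory.Modular
import Mathlib.MeasureTheory.Measure.Lebesgue.Complex
import HarnessLib

/-!
# Silverman 1986, covolume form — proofs

Discharges the two named facts of
`Literature/NumberTheory/EllipticCurves/SilvermanHeightCovolume.lean`:

* `silverman1986_discriminant_c4_covolume_holds : silverman1986_discriminant_c4_covolume`
  (`max(|Δ_min|, |c₄|³) ≤ A_ε covol(Λ_Néron)^{-(6+ε)}`), and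
* `silverman1986_c6_covolume_holds : silverman1986_c6_covolume`
  (`|c₆|² ≤ A_ε covol(Λ_Néron)^{-(6+ε)}`),

for global minimal Weierstrass models over `ℚ` (J. H. Silverman, *Heights and elliptic curves*,
in: Arithmetic Geometry (Cornell–Silverman eds.), Springer 1986, Prop. 1.1, §2 (4)–(6), Cor. 2.3;
held as `book:cornellnd-arithmetic-geometry`, pp. 330–334, read).

## The argument (Silverman's Prop. 1.1 and estimate (4), specialised to `K = ℚ`)

Everything is proved from Mathlib's level-one theory (`ModularForm.discriminant = η²⁴` as a
weight-12 cusp form, the normalised Eisenstein series `E₄`, `E₆`,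
`ModularForm.discriminant_eq_E₄_cube_sub_E₆_sq`,
`EisensteinSeries.tsum_eisSummand_eq_riemannZeta_mul_eisensteinSeries`,
`ModularGroup.exists_smul_mem_fd`):

* (A) every period lattice is `Λ = ω(ℤτ + ℤ)` with `τ` in the standard fundamental domain `𝒟`, in
  the sense that the lattice sums are `G_k(Λ) = ω^{-k} G_k(τ)`, `G_k(τ) = ∑_{(m,n)≠0}(mτ+n)^{-k}`;
* (B) `covol(Λ) = |ω|² Im τ` (`ZLattice.covolume` for Lebesgue measure on `ℂ`);
* (C) `G₄(τ) = (π⁴/45) E₄(τ)`, `G₆(τ) = (2π⁶/945) E₆(τ)` (`ζ(4) = π⁴/90`, `ζ(6) = π⁶/945`), so for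
  a Néron lattice (`g₂ = c₄/12`, `g₃ = c₆/216`): `c₄ = 16π⁴ω⁻⁴E₄(τ)`, `c₆ = 64π⁶ω⁻⁶E₆(τ)` and
  `Δ_min = (c₄³ − c₆²)/1728 = (2π)¹²ω⁻¹²Δ(τ)`;
* (D) on `Im τ ≥ 1/2 (⊇ 𝒟)`: `E₄`, `E₆` are bounded and `|Δ(τ)| ≤ M e^{-2π Im τ}` (Silverman's (4),
  from `Δ = q∏(1 − qⁿ)²⁴` and continuity of the `q`-expansions on `|q| ≤ e^{-π}`);
* (E) `Δ_min ∈ ℤ ∖ {0}` gives `1 ≤ |Δ_min| ≤ (2π)¹²M|ω|⁻¹²e^{-2π Im τ}`, i.e.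
  `|ω|¹² ≪ e^{-2π Im τ}`, hence `|ω|^{2ε}(Im τ)^{6+ε} ≪_ε 1`; with
  `covol^{-(6+ε)} = (|ω|¹² · |ω|^{2ε}(Im τ)^{6+ε})⁻¹` this is the claim.

All helper lemmas are `private`; the only public declarations are the two `_holds` theorems
(namespace `Literature.NumberTheory.EllipticCurves.ModularForms`, as the facts).

## References

* J. H. Silverman, *Heights and elliptic curves*, in G. Cornell, J. H. Silverman (eds.),
  Arithmetic Geometry, Springer (1986): Prop. 1.1, §2 (4)–(6), Cor. 2.3. [Silverman1986]
* J. H. Silverman, *The Arithmetic of Elliptic Curves*, 2nd ed. (2009), VI.3.6 (uniformisation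
  identities). [SilvermanAEC2009]
-/

noncomputable section

open _root_.Complex _root_.UpperHalfPlane _root_.EisensteinSeries _root_.ModularForm
open scoped MatrixGroups Real Topology

namespace Literature.NumberTheory.EllipticCurves.ModularForms

/-! ### A. Lattice sums of a period pair as level-one Eisenstein sums -/

/-- `G_k(γ • τ) = (cτ + d)^k G_k(τ)` for the full lattice sum `G_k(τ) = ∑_{(m,n) ≠ 0} (mτ+n)^{-k}`
(reindex by the permutation `v ↦ v γ` of `ℤ²`). [folklore] -/
private lemma tsum_eisSummand_smul (k : ℤ) (γ : SL(2, ℤ)) (τ : ℍ) :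
    ∑' v : Fin 2 → ℤ, eisSummand k v (γ • τ) =
      denom γ τ ^ k * ∑' v : Fin 2 → ℤ, eisSummand k v τ := by
  simp_rw [eisSummand_SL2_apply, tsum_mul_left]
  congr 1
  exact (⟨fun v => Matrix.vecMul v (γ : Matrix (Fin 2) (Fin 2) ℤ),
    fun v => Matrix.vecMul v ((γ⁻¹ : SL(2, ℤ)) : Matrix (Fin 2) (Fin 2) ℤ),
    fun v => by
      simp_rw [Matrix.vecMul_vecMul, ← Matrix.SpecialLinearGroup.coe_mul, mul_inv_cancel,
        Matrix.SpecialLinearGroup.coe_one, Matrix.vecMul_one],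
    fun v => by
      simp_rw [Matrix.vecMul_vecMul, ← Matrix.SpecialLinearGroup.coe_mul, inv_mul_cancel,
        Matrix.SpecialLinearGroup.coe_one, Matrix.vecMul_one]⟩ : (Fin 2 → ℤ) ≃ (Fin 2 → ℤ)).tsum_eq
    (fun v => eisSummand k v τ)

/-- The first period of a period pair is nonzero. [folklore] -/
private lemma periodPair_ω₁_ne_zero (L : PeriodPair) : L.ω₁ ≠ 0 := by
  have := L.indep.ne_zero 0
  simpa using this

/-- The period ratio `ω₂/ω₁` of a period pair is not real. [folklore] -/
private lemma periodPair_im_div_ne_zero (L : PeriodPair) : (L.ω₂ / L.ω₁).im ≠ 0 := by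
  intro h
  have h1 : L.ω₂ = ((L.ω₂ / L.ω₁).re : ℂ) * L.ω₁ := by
    have : L.ω₂ / L.ω₁ = ((L.ω₂ / L.ω₁).re : ℂ) := by
      apply Complex.ext <;> simp [h]
    rw [← this, div_mul_cancel₀ _ (periodPair_ω₁_ne_zero L)]
  have h2 := LinearIndependent.pair_iff.mp L.indep ((L.ω₂ / L.ω₁).re) (-1) (by
    simp only [Complex.real_smul]
    rw [← h1]; push_cast; ring)
  simpa using h2.2

/-- The lattice sums of `L` in terms of `τ = s ω₂/ω₁ ∈ ℍ` (`s = ±1`), reindexing `Λ` by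
`ℤ² ≃ Λ`, `(m, n) ↦ n ω₁ + (s m) ω₂ = ω₁ (m τ + n)`. [folklore] -/
private lemma periodPair_G_eq_tsum (L : PeriodPair) (s : ℤˣ) (τ : ℍ)
    (hτ : (τ : ℂ) = (s : ℤ) * (L.ω₂ / L.ω₁)) (k : ℕ) :
    L.G k = (L.ω₁ ^ k)⁻¹ * ∑' v : Fin 2 → ℤ, eisSummand k v τ := by
  let e : (Fin 2 → ℤ) ≃ L.lattice := (finTwoArrowEquiv ℤ).trans <| (Equiv.prodComm ℤ ℤ).trans <|
    ((Equiv.refl ℤ).prodCongr s.mulLeft).trans L.latticeEquivProd.symm.toEquiv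
  have he : ∀ v, ((e v : L.lattice) : ℂ) = v 1 * L.ω₁ + ((s : ℤ) * v 0 : ℤ) * L.ω₂ := fun v => by
    simp [e, PeriodPair.latticeEquiv_symm_apply]
  rw [PeriodPair.G, ← e.tsum_eq, ← tsum_mul_left]
  congr 1 with v
  rw [he, eisSummand, zpow_neg, zpow_natCast, ← mul_inv, ← mul_pow]
  congr 2
  rw [hτ]
  have h1 := periodPair_ω₁_ne_zero L
  field_simp
  push_cast
  ring

/-- First reduction: a period pair has `τ₀ = ±ω₂/ω₁ ∈ ℍ` with `G_k(L) = ω₁^{-k} G_k(τ₀)` and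
`Im τ₀ = |Im(ω₂/ω₁)|`. [folklore] -/
private lemma periodPair_exists_tau (L : PeriodPair) : ∃ τ : ℍ,
    (∀ k : ℕ, L.G k = (L.ω₁ ^ k)⁻¹ * ∑' v : Fin 2 → ℤ, eisSummand k v τ) ∧
      τ.im = |(L.ω₂ / L.ω₁).im| := by
  rcases lt_or_gt_of_ne (periodPair_im_div_ne_zero L) with h | h
  · refine ⟨UpperHalfPlane.mk (-(L.ω₂ / L.ω₁)) (by simpa using h), fun k => ?_, ?_⟩
    · refine periodPair_G_eq_tsum L (-1) _ ?_ k
      simp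
    · simp [abs_of_neg h]
  · refine ⟨UpperHalfPlane.mk (L.ω₂ / L.ω₁) h, fun k => ?_, ?_⟩
    · refine periodPair_G_eq_tsum L 1 _ ?_ k
      simp
    · simp [abs_of_pos h]

/-- Second reduction: move `τ` into the standard fundamental domain `𝒟` by `γ ∈ SL(2, ℤ)`,
replacing `ω₁` by `ω₁ (cτ₀ + d)`; `|ω|² Im τ` is unchanged. [folklore] -/
private lemma periodPair_exists_omega_tau_fd (L : PeriodPair) : ∃ (ω : ℂ) (τ : ℍ),
    ω ≠ 0 ∧ τ ∈ ModularGroup.fd ∧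
    (∀ k : ℕ, L.G k = (ω ^ k)⁻¹ * ∑' v : Fin 2 → ℤ, eisSummand k v τ) ∧
      ‖ω‖ ^ 2 * τ.im = ‖L.ω₁‖ ^ 2 * |(L.ω₂ / L.ω₁).im| := by
  obtain ⟨τ₀, hG, him⟩ := periodPair_exists_tau L
  obtain ⟨g, hg⟩ := ModularGroup.exists_smul_mem_fd τ₀
  refine ⟨L.ω₁ * denom g τ₀, g • τ₀, mul_ne_zero (periodPair_ω₁_ne_zero L) (denom_ne_zero g τ₀),
    hg, fun k => ?_, ?_⟩
  · rw [hG k, tsum_eisSummand_smul, mul_pow, mul_inv, mul_assoc, zpow_natCast,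
      inv_mul_cancel_left₀ (pow_ne_zero _ (denom_ne_zero g τ₀))]
  · rw [ModularGroup.im_smul_eq_div_normSq, Complex.normSq_eq_norm_sq, norm_mul, him]
    have := norm_pos_iff.mpr (denom_ne_zero g τ₀)
    field_simp


/-! ### B. The covolume of the period lattice -/

/-- The fundamental domain of the basis `(1, i)` of `ℂ` has Lebesgue measure `1`. [folklore] -/
private lemma volume_real_fundamentalDomain_basisOneI :
    (MeasureTheory.volume : MeasureTheory.Measure ℂ).real
      (ZSpan.fundamentalDomain Complex.basisOneI) = 1 := by
  rw [MeasureTheory.measureReal_congr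
      (ZSpan.fundamentalDomain_ae_parallelepiped Complex.basisOneI MeasureTheory.volume),
    ← Complex.toBasis_orthonormalBasisOneI, OrthonormalBasis.coe_toBasis,
    MeasureTheory.measureReal_def, Complex.orthonormalBasisOneI.volume_parallelepiped,
    ENNReal.toReal_one]

/-- `covol(ℤω₁ + ℤω₂) = |ω₁|² |Im(ω₂/ω₁)|` (area of the fundamental parallelogram). [folklore] -/
private lemma periodPair_covolume (L : PeriodPair) :
    ZLattice.covolume L.lattice = ‖L.ω₁‖ ^ 2 * |(L.ω₂ / L.ω₁).im| := by
  rw [ZLattice.covolume_eq_det_mul_measureReal (L := L.lattice) (μ := MeasureTheory.volume)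
      (b := L.latticeBasis) (b₀ := Complex.basisOneI),
    volume_real_fundamentalDomain_basisOneI, mul_one, Module.Basis.det_apply, Matrix.det_fin_two]
  simp only [Module.Basis.toMatrix_apply, Function.comp_apply, PeriodPair.latticeBasis_zero,
    PeriodPair.latticeBasis_one, Complex.coe_basisOneI_repr, Matrix.cons_val_zero,
    Matrix.cons_val_one]
  have h1 := periodPair_ω₁_ne_zero L
  have key : L.ω₁.re * L.ω₂.im - L.ω₂.re * L.ω₁.im = ‖L.ω₁‖ ^ 2 * (L.ω₂ / L.ω₁).im := by
    rw [Complex.div_im, ← Complex.normSq_eq_norm_sq]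
    have : Complex.normSq L.ω₁ ≠ 0 := by simpa using h1
    field_simp
  rw [key, abs_mul, abs_of_nonneg (by positivity)]

/-- The reduction used below: every period lattice is `ω(ℤτ + ℤ)` with `τ ∈ 𝒟`, in the sense that
`G_k(L) = ω^{-k} G_k(τ)` for all `k` and `covol(L) = |ω|² Im τ`. [folklore] -/
private lemma periodPair_reduction (L : PeriodPair) : ∃ (ω : ℂ) (τ : ℍ),
    ω ≠ 0 ∧ τ ∈ ModularGroup.fd ∧
    (∀ k : ℕ, L.G k = (ω ^ k)⁻¹ * ∑' v : Fin 2 → ℤ, eisSummand k v τ) ∧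
      ZLattice.covolume L.lattice = ‖ω‖ ^ 2 * τ.im := by
  obtain ⟨ω, τ, hω, hτ, hG, hcov⟩ := periodPair_exists_omega_tau_fd L
  exact ⟨ω, τ, hω, hτ, hG, by rw [periodPair_covolume, hcov]⟩

/-! ### C. `c₄` and `Δ` through `E₄`, `E₆` and the modular discriminant -/

/-- `∑_{(m,n) ≠ 0} (mτ+n)^{-k} = 2ζ(k) E_k(τ)` for `k ≥ 3` (Mathlib's normalised `E_k`).
[folklore] -/
private lemma tsum_eisSummand_eq_E {k : ℕ} (hk : 3 ≤ k) (τ : ℍ) :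
    ∑' v : Fin 2 → ℤ, eisSummand k v τ = 2 * riemannZeta k * E hk τ := by
  rw [tsum_eisSummand_eq_riemannZeta_mul_eisensteinSeries hk τ,
    show E hk τ = (1 / 2 : ℂ) • eisensteinSeriesSIF (N := 1) 0 k τ from rfl,
    eisensteinSeriesSIF_apply, smul_eq_mul]
  ring

/-- `B₆ = 1/42`. [folklore] -/
private lemma bernoulli_six : bernoulli 6 = 1 / 42 := by
  rw [bernoulli_eq_bernoulli'_of_ne_one (by decide), bernoulli'_def]
  have h5 : bernoulli' 5 = 0 := bernoulli'_eq_zero_of_odd (by decide) (by norm_num)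
  norm_num [Finset.sum_range_succ, h5, Nat.choose]

/-- `ζ(6) = π⁶/945` (Euler). [folklore] -/
private lemma riemannZeta_six : riemannZeta 6 = (π : ℂ) ^ 6 / 945 := by
  have h := riemannZeta_two_mul_nat (k := 3) (by norm_num)
  norm_num at h
  rw [h, bernoulli_six]
  norm_num [Nat.factorial]
  ring

/-- `G₄(τ) = ∑_{(m,n) ≠ 0} (mτ+n)^{-4} = (π⁴/45) E₄(τ)`. [folklore] -/
private lemma G_four_eq (τ : ℍ) :
    ∑' v : Fin 2 → ℤ, eisSummand ((4 : ℕ) : ℤ) v τ = (π : ℂ) ^ 4 / 45 * E₄ τ := by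
  rw [tsum_eisSummand_eq_E (by norm_num) τ]
  norm_num [riemannZeta_four]
  left
  ring

/-- `G₆(τ) = ∑_{(m,n) ≠ 0} (mτ+n)^{-6} = (2π⁶/945) E₆(τ)`. [folklore] -/
private lemma G_six_eq (τ : ℍ) :
    ∑' v : Fin 2 → ℤ, eisSummand ((6 : ℕ) : ℤ) v τ = 2 * (π : ℂ) ^ 6 / 945 * E₆ τ := by
  rw [tsum_eisSummand_eq_E (by norm_num) τ]
  norm_num [riemannZeta_six]
  left
  ring

/-- For a Néron lattice written as `ω(ℤτ + ℤ)`: `c₄ = 16π⁴ ω⁻⁴ E₄(τ)`, `c₆ = 64π⁶ ω⁻⁶ E₆(τ)`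
and `Δ = (2π)¹² ω⁻¹² Δ(τ)` (the classical uniformisation identities, Silverman AEC VI.3.6, with
`Δ = (E₄³ − E₆²)/1728`). [folklore] -/
private lemma neron_c₄_c₆_Δ_eq {W : WeierstrassCurve ℚ} {L : PeriodPair}
    (hN : IsNeronLatticeOf (W.baseChange ℂ) L) {ω : ℂ} {τ : ℍ}
    (hG : ∀ k : ℕ, L.G k = (ω ^ k)⁻¹ * ∑' v : Fin 2 → ℤ, eisSummand k v τ) :
    ((W.c₄ : ℚ) : ℂ) = 16 * π ^ 4 * (ω ^ 4)⁻¹ * E₄ τ ∧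
    ((W.c₆ : ℚ) : ℂ) = 64 * π ^ 6 * (ω ^ 6)⁻¹ * E₆ τ ∧
    ((W.Δ : ℚ) : ℂ) = 4096 * π ^ 12 * (ω ^ 12)⁻¹ * ModularForm.discriminant τ := by
  obtain ⟨h2, h3⟩ := hN
  rw [WeierstrassCurve.baseChange, WeierstrassCurve.map_c₄, eq_ratCast] at h2
  rw [WeierstrassCurve.baseChange, WeierstrassCurve.map_c₆, eq_ratCast] at h3
  rw [PeriodPair.g₂, hG 4, G_four_eq] at h2
  rw [PeriodPair.g₃, hG 6, G_six_eq] at h3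
  have hc4 : ((W.c₄ : ℚ) : ℂ) = 16 * π ^ 4 * (ω ^ 4)⁻¹ * E₄ τ := by
    linear_combination (-12 : ℂ) * h2
  have hc6 : ((W.c₆ : ℚ) : ℂ) = 64 * π ^ 6 * (ω ^ 6)⁻¹ * E₆ τ := by
    linear_combination (-216 : ℂ) * h3
  refine ⟨hc4, hc6, ?_⟩
  have hrel := congrArg (fun q : ℚ => (q : ℂ)) W.c_relation
  simp only [Rat.cast_mul, Rat.cast_sub, Rat.cast_pow, Rat.cast_ofNat] at hrel
  rw [hc4, hc6] at hrel
  have hΔ := discriminant_eq_E₄_cube_sub_E₆_sq τ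
  have hω4 : (ω ^ 4)⁻¹ = (ω⁻¹) ^ 4 := by rw [inv_pow]
  have hω6 : (ω ^ 6)⁻¹ = (ω⁻¹) ^ 6 := by rw [inv_pow]
  have hω12 : (ω ^ 12)⁻¹ = (ω⁻¹) ^ 12 := by rw [inv_pow]
  rw [hω12, hΔ]
  rw [hω4, hω6] at hrel
  linear_combination hrel / 1728

/-! ### D. Bounds for `Im τ ≥ 1/2`: `E₄` is bounded and `Δ(τ) = O(e^{-2π Im τ})` -/

/-- `|q_τ| = e^{-2π Im τ}`. [folklore] -/
private lemma norm_qParam_one (τ : ℍ) :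
    ‖Function.Periodic.qParam 1 (τ : ℂ)‖ = Real.exp (-2 * π * τ.im) := by
  rw [Function.Periodic.norm_qParam, div_one, UpperHalfPlane.coe_im]

/-- `|q_τ| ≤ e^{-2πδ}` when `Im τ ≥ δ`. [folklore] -/
private lemma norm_qParam_one_le (τ : ℍ) {δ : ℝ} (hτ : δ ≤ τ.im) :
    ‖Function.Periodic.qParam 1 (τ : ℂ)‖ ≤ Real.exp (-2 * π * δ) := by
  rw [norm_qParam_one, Real.exp_le_exp]
  nlinarith [Real.pi_pos]

/-- `e^{-π} < 1`. [folklore] -/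
private lemma exp_neg_pi_lt_one : Real.exp (-2 * π * (1 / 2)) < 1 := by
  rw [Real.exp_lt_one_iff]
  nlinarith [Real.pi_pos]

/-- A function continuous on the open unit disc is bounded on every smaller closed disc.
[folklore] -/
private lemma exists_bound_of_continuousOn_ball {F : ℂ → ℂ}
    (hF : ContinuousOn F (Metric.ball 0 1)) {r : ℝ} (hr : r < 1) :
    ∃ M, 0 ≤ M ∧ ∀ q : ℂ, ‖q‖ ≤ r → ‖F q‖ ≤ M := by
  obtain ⟨M, hM⟩ := (isCompact_closedBall (0 : ℂ) r).exists_bound_of_continuousOn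
    (hF.mono (Metric.closedBall_subset_ball hr))
  exact ⟨max M 0, le_max_right _ _,
    fun q hq => (hM q (by simpa using hq)).trans (le_max_left _ _)⟩

/-- The Eisenstein series `E_k` (`k ≥ 3`) is bounded on `Im τ ≥ 1/2` (continuity of its
`q`-expansion on `|q| ≤ e^{-π}`). [folklore] -/
private lemma exists_bound_E {k : ℕ} (hk : 3 ≤ k) :
    ∃ M, 0 ≤ M ∧ ∀ τ : ℍ, 1 / 2 ≤ τ.im → ‖E hk τ‖ ≤ M := by
  have hF : ContinuousOn (cuspFunction 1 (E hk)) (Metric.ball (0 : ℂ) 1) :=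
    fun q hq => (ModularFormClass.differentiableAt_cuspFunction (E hk) one_pos
      one_mem_strictPeriods_SL (mem_ball_zero_iff.mp hq)).continuousAt.continuousWithinAt
  obtain ⟨M, hM0, hM⟩ := exists_bound_of_continuousOn_ball hF exp_neg_pi_lt_one
  refine ⟨M, hM0, fun τ hτ => ?_⟩
  rw [← SlashInvariantFormClass.eq_cuspFunction (E hk) τ one_mem_strictPeriods_SL one_ne_zero]
  exact hM _ (norm_qParam_one_le τ hτ)

/-- `|Δ(τ)| ≤ M e^{-2π Im τ}` on `Im τ ≥ 1/2` (Silverman's (4): `log|Δ(τ)| = log|q_τ| + O(1)`),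
from `Δ = q ∏ (1 - qⁿ)²⁴` and continuity of the product on `|q| ≤ e^{-π}`.
[cite: Silverman1986, §2 eq. (4)] -/
private lemma exists_bound_discriminant : ∃ M, 0 ≤ M ∧ ∀ τ : ℍ, 1 / 2 ≤ τ.im →
    ‖ModularForm.discriminant τ‖ ≤ M * Real.exp (-2 * π * τ.im) := by
  have hF : ContinuousOn (fun q : ℂ => ∏' i, (1 - q ^ (i + 1)) ^ 24) (Metric.ball 0 1) :=
    (differentiableOn_tprod_one_sub_pow_pow 24).continuousOn
  obtain ⟨M, hM0, hM⟩ := exists_bound_of_continuousOn_ball hF exp_neg_pi_lt_one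
  refine ⟨M, hM0, fun τ hτ => ?_⟩
  have h := hM _ (norm_qParam_one_le τ hτ)
  rw [discriminant_eq_q_prod, norm_mul, norm_qParam_one, mul_comm]
  simp only [eta_q] at h ⊢
  gcongr

/-! ### E. Assembly -/

/-- `y ↦ y^s e^{-b y}` (`s ≥ 0`, `b > 0`) is bounded on `[0, ∞)`. [folklore] -/
private lemma exists_bound_rpow_mul_exp_neg (s b : ℝ) (hs : 0 ≤ s) (hb : 0 < b) :
    ∃ S, 0 ≤ S ∧ ∀ y : ℝ, 0 ≤ y → y ^ s * Real.exp (-b * y) ≤ S := by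
  have hev : ∀ᶠ y in Filter.atTop, y ^ s * Real.exp (-b * y) ≤ 1 :=
    (tendsto_rpow_mul_exp_neg_mul_atTop_nhds_zero s b hb).eventually (eventually_le_nhds one_pos)
  obtain ⟨Y, hY⟩ := Filter.eventually_atTop.mp hev
  refine ⟨max 1 ((max Y 0) ^ s), by positivity, fun y hy => ?_⟩
  rcases le_or_gt Y y with h | h
  · exact (hY y h).trans (le_max_left _ _)
  · calc y ^ s * Real.exp (-b * y) ≤ y ^ s * 1 := by
          gcongr
          rw [Real.exp_le_one_iff]
          nlinarith
      _ ≤ (max Y 0) ^ s := by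
          rw [mul_one]
          exact Real.rpow_le_rpow hy (le_max_of_le_left h.le) hs
      _ ≤ _ := le_max_right _ _

/-- The common core of both facts: `max(|Δ_min|, |c₄|³, |c₆|²) ≤ A_ε covol(Λ)^{-(6+ε)}` for a
global minimal model over `ℚ` and its Néron lattice `Λ`.
[cite: Silverman1986, Cor. 2.3 with Prop. 1.1] -/
private lemma silverman1986_covolume_core (ε : ℝ) (hε : 0 < ε) : ∃ A : ℝ,
    ∀ (W : WeierstrassCurve ℚ) [W.IsElliptic] [W.IsGloballyMinimal] (L : PeriodPair),
      IsNeronLatticeOf (W.baseChange ℂ) L →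
        max (max |(W.Δ : ℝ)| (|(W.c₄ : ℝ)| ^ 3)) (|(W.c₆ : ℝ)| ^ 2) ≤
          A * ZLattice.covolume L.lattice ^ (-(6 + ε)) := by
  obtain ⟨M₄, hM₄0, hM₄⟩ := exists_bound_E (k := 4) (by norm_num)
  obtain ⟨M₆, hM₆0, hM₆⟩ := exists_bound_E (k := 6) (by norm_num)
  obtain ⟨MΔ, hMΔ0, hMΔ⟩ := exists_bound_discriminant
  obtain ⟨S, hS0, hS⟩ :=
    exists_bound_rpow_mul_exp_neg (6 + ε) (π * ε / 3) (by linarith) (by positivity)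
  set CΔ : ℝ := 4096 * π ^ 12 * MΔ with hCΔ
  set C₄ : ℝ := 4096 * π ^ 12 * M₄ ^ 3 with hC₄
  set C₆ : ℝ := 4096 * π ^ 12 * M₆ ^ 2 with hC₆
  have hCΔ0 : 0 ≤ CΔ := by positivity
  set K : ℝ := max (max CΔ C₄) C₆ with hK
  refine ⟨K * (CΔ ^ (ε / 6) * S), ?_⟩
  intro W _ _ L hN
  obtain ⟨ω, τ, hω, hτfd, hG, hcov⟩ := periodPair_reduction L
  obtain ⟨hc4, hc6, hΔ⟩ := neron_c₄_c₆_Δ_eq hN hG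
  have hτ : 1 / 2 ≤ τ.im := by
    have h3 := ModularGroup.three_le_four_mul_im_sq_of_mem_fd hτfd
    nlinarith [τ.im_pos]
  set r : ℝ := ‖ω‖ with hr
  have hr0 : 0 < r := norm_pos_iff.mpr hω
  set y : ℝ := τ.im with hy
  have hy0 : 0 < y := τ.im_pos
  -- the three norms
  have hnormΔ : |(W.Δ : ℝ)| = 4096 * π ^ 12 * (r ^ 12)⁻¹ * ‖ModularForm.discriminant τ‖ := by
    rw [← Complex.norm_ratCast, hΔ]
    simp [norm_inv, norm_pow, Complex.norm_real, abs_of_pos Real.pi_pos, hr]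
  have hnormc4 : |(W.c₄ : ℝ)| ^ 3 = 4096 * π ^ 12 * (r ^ 12)⁻¹ * ‖E₄ τ‖ ^ 3 := by
    rw [← Complex.norm_ratCast, hc4]
    simp [norm_inv, norm_pow, Complex.norm_real, abs_of_pos Real.pi_pos, hr]
    ring
  have hnormc6 : |(W.c₆ : ℝ)| ^ 2 = 4096 * π ^ 12 * (r ^ 12)⁻¹ * ‖E₆ τ‖ ^ 2 := by
    rw [← Complex.norm_ratCast, hc6]
    simp [norm_inv, norm_pow, Complex.norm_real, abs_of_pos Real.pi_pos, hr]
    ring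
  -- integrality of the minimal discriminant
  have hΔ1 : 1 ≤ |(W.Δ : ℝ)| := by
    rw [← WeierstrassCurve.cast_minimalDiscriminantInt W, Rat.cast_intCast]
    exact_mod_cast Int.one_le_abs (WeierstrassCurve.minimalDiscriminantInt_ne_zero W)
  -- `|Δ_min| ≤ CΔ r⁻¹² e^{-2πy}` and hence `r¹² ≤ CΔ e^{-2πy}`
  have hΔle : |(W.Δ : ℝ)| ≤ CΔ * (r ^ 12)⁻¹ * Real.exp (-2 * π * y) := by
    rw [hnormΔ, hCΔ]
    have := hMΔ τ hτ
    calc 4096 * π ^ 12 * (r ^ 12)⁻¹ * ‖ModularForm.discriminant τ‖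
        ≤ 4096 * π ^ 12 * (r ^ 12)⁻¹ * (MΔ * Real.exp (-2 * π * y)) := by gcongr
      _ = _ := by ring
  have hr12 : r ^ 12 ≤ CΔ * Real.exp (-2 * π * y) := by
    have h := hΔ1.trans hΔle
    have hr12pos : 0 < r ^ 12 := by positivity
    rw [mul_comm (CΔ), mul_assoc, ← div_eq_inv_mul, le_div_iff₀ hr12pos, one_mul] at h
    linarith
  -- `|c₄|³ ≤ C₄ r⁻¹²`, `|c₆|² ≤ C₆ r⁻¹²`, `|Δ_min| ≤ CΔ r⁻¹²`
  have hc4le : |(W.c₄ : ℝ)| ^ 3 ≤ C₄ * (r ^ 12)⁻¹ := by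
    rw [hnormc4, hC₄]
    have := hM₄ τ hτ
    calc 4096 * π ^ 12 * (r ^ 12)⁻¹ * ‖E₄ τ‖ ^ 3
        ≤ 4096 * π ^ 12 * (r ^ 12)⁻¹ * M₄ ^ 3 := by gcongr
      _ = _ := by ring
  have hc6le : |(W.c₆ : ℝ)| ^ 2 ≤ C₆ * (r ^ 12)⁻¹ := by
    rw [hnormc6, hC₆]
    have := hM₆ τ hτ
    calc 4096 * π ^ 12 * (r ^ 12)⁻¹ * ‖E₆ τ‖ ^ 2
        ≤ 4096 * π ^ 12 * (r ^ 12)⁻¹ * M₆ ^ 2 := by gcongr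
      _ = _ := by ring
  have hΔle' : |(W.Δ : ℝ)| ≤ CΔ * (r ^ 12)⁻¹ := by
    refine hΔle.trans ?_
    have : Real.exp (-2 * π * y) ≤ 1 := by
      rw [Real.exp_le_one_iff]; nlinarith [Real.pi_pos]
    calc CΔ * (r ^ 12)⁻¹ * Real.exp (-2 * π * y) ≤ CΔ * (r ^ 12)⁻¹ * 1 := by gcongr
      _ = _ := mul_one _
  have hmax : max (max |(W.Δ : ℝ)| (|(W.c₄ : ℝ)| ^ 3)) (|(W.c₆ : ℝ)| ^ 2) ≤ K * (r ^ 12)⁻¹ := by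
    refine max_le (max_le ?_ ?_) ?_
    · exact hΔle'.trans (by gcongr; exact le_max_of_le_left (le_max_left _ _))
    · exact hc4le.trans (by gcongr; exact le_max_of_le_left (le_max_right _ _))
    · exact hc6le.trans (by gcongr; exact le_max_right _ _)
  -- the key estimate `r^{2ε} y^{6+ε} ≤ CΔ^{ε/6} S`
  have hkey : r ^ (2 * ε) * y ^ (6 + ε) ≤ CΔ ^ (ε / 6) * S := by
    have h1 : r ^ (2 * ε) = (r ^ 12) ^ (ε / 6) := by
      rw [← Real.rpow_natCast r 12, ← Real.rpow_mul hr0.le]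
      congr 1
      push_cast
      ring
    have h3 : (CΔ * Real.exp (-2 * π * y)) ^ (ε / 6) =
        CΔ ^ (ε / 6) * Real.exp (-(π * ε / 3) * y) := by
      rw [Real.mul_rpow hCΔ0 (Real.exp_pos _).le, ← Real.exp_mul]
      congr 2
      ring
    calc r ^ (2 * ε) * y ^ (6 + ε) = (r ^ 12) ^ (ε / 6) * y ^ (6 + ε) := by rw [h1]
      _ ≤ (CΔ * Real.exp (-2 * π * y)) ^ (ε / 6) * y ^ (6 + ε) := by gcongr
      _ = CΔ ^ (ε / 6) * (y ^ (6 + ε) * Real.exp (-(π * ε / 3) * y)) := by rw [h3]; ring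
      _ ≤ CΔ ^ (ε / 6) * S := by gcongr; exact hS y hy0.le
  -- the covolume power `covol^{-(6+ε)} = (r¹² · r^{2ε} y^{6+ε})⁻¹`
  have hpos : 0 < r ^ (2 * ε) * y ^ (6 + ε) := by positivity
  have hcovpow : ZLattice.covolume L.lattice ^ (-(6 + ε)) =
      (r ^ 12 * (r ^ (2 * ε) * y ^ (6 + ε)))⁻¹ := by
    rw [hcov, Real.rpow_neg (by positivity), Real.mul_rpow (by positivity) hy0.le]
    congr 1
    rw [← Real.rpow_natCast r 2, ← Real.rpow_mul hr0.le,
      show ((2 : ℕ) : ℝ) * (6 + ε) = ((12 : ℕ) : ℝ) + 2 * ε by push_cast; ring,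
      Real.rpow_add hr0, Real.rpow_natCast]
    ring
  have hK0 : 0 ≤ K := le_max_of_le_left (le_max_of_le_left hCΔ0)
  rw [hcovpow]
  calc max (max |(W.Δ : ℝ)| (|(W.c₄ : ℝ)| ^ 3)) (|(W.c₆ : ℝ)| ^ 2) ≤ K * (r ^ 12)⁻¹ := hmax
    _ = K * (r ^ (2 * ε) * y ^ (6 + ε)) * (r ^ 12 * (r ^ (2 * ε) * y ^ (6 + ε)))⁻¹ := by
        field_simp
    _ ≤ K * (CΔ ^ (ε / 6) * S) * (r ^ 12 * (r ^ (2 * ε) * y ^ (6 + ε)))⁻¹ := by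
        gcongr

/-- **Silverman 1986, Cor. 2.3 with Prop. 1.1 (covolume form)** — proved. The proof is the
classical uniformisation computation behind Silverman's Prop. 1.1 and estimate (4): writing the
Néron lattice as `Λ = ω(ℤτ + ℤ)` with `τ` in the standard fundamental domain,
`c₄ = 16π⁴ω⁻⁴E₄(τ)` and `Δ_min = (2π)¹²ω⁻¹²Δ(τ)` with `|Δ(τ)| ≪ e^{-2π Im τ}` and
`covol(Λ) = |ω|² Im τ`; integrality `|Δ_min| ≥ 1` then gives `|ω|¹² ≪ e^{-2π Im τ}`, whence
`|ω|^{2ε}(Im τ)^{6+ε} ≪_ε 1` and the bound. [cite: Silverman1986, Prop. 1.1 and §2 (4)–(6),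
Cor. 2.3 (Arithmetic Geometry, Ch. X, pp. 253–257 of the chapter = pp. 330–334 of the volume)] -/
theorem silverman1986_discriminant_c4_covolume_holds : silverman1986_discriminant_c4_covolume := by
  intro ε hε
  obtain ⟨A, hA⟩ := silverman1986_covolume_core ε hε
  refine ⟨A, fun W _ _ L hN => ?_⟩
  have h := hA W L hN
  push_cast
  exact (le_max_left _ _).trans h

/-- **Silverman 1986, Cor. 2.3 (second display) with Prop. 1.1 (covolume form)** — proved, by the
same computation (`c₆ = 64π⁶ω⁻⁶E₆(τ)` with `E₆` bounded on the fundamental domain).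
[cite: Silverman1986, Cor. 2.3 (second display) with Prop. 1.1] -/
theorem silverman1986_c6_covolume_holds : silverman1986_c6_covolume := by
  intro ε hε
  obtain ⟨A, hA⟩ := silverman1986_covolume_core ε hε
  refine ⟨A, fun W _ _ L hN => ?_⟩
  have h := hA W L hN
  push_cast
  exact (le_max_right _ _).trans h

end Literature.NumberTheory.EllipticCurves.ModularForms

end
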